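import Literature.Probability.Percolation.StaircaseJunctions
import Literature.Probability.Percolation.StaircaseSeparation
import HarnessLib

/-!
# Level connectors of the staircase corridors against the ring tubes

Topic: Probability / Percolation; family `crit-perc`. A brick of the GENERIC landing layer of
Nolin's arm-separation theorem (Nolin 2008, Thm. 11, §4.4 [arXiv 0711.4948: Thm. 10, p. 12,
Fig. 6: "RSW in corridors"]), towards
`Literature.Probability.Percolation.Nolin2008_prop17_quasiMult` (`FiveArmExponentFacts.lean`).

Where the level connectors are (`Staircase.levelConn_bounds`: in the frame of their side, the
lateral coordinate within `e'` of the centre `-r + l s + s/2` of their cell, the depth between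
`r - s/2 - 2e'` and `r' + 2e'`), and the consequence for the regions of the corridors: a
connector at a cell at least two cells away from the corners of its side is disjoint from every
tube of the thin rings of radii `r` and `r'` on the OTHER sides, and from the tubes of its own
side at lateral distance at least two cells (`Staircase.levelConn_disjoint_ringTube`) — by
coordinates, with `ringTube_bounds` and `ringTube_dep` (`StaircaseSeparation.lean`).

## Main results

* `Staircase.levelConn_bounds`, `Staircase.levelConn_disjoint_ringTube`.

## References

* P. Nolin, *Near-critical percolation in two dimensions*, Electron. J. Probab. 13 (2008), §4.3
  Prop. 12 (proof), §4.4 (arXiv 0711.4948: Prop. 11; proof of Thm. 10, p. 12, Fig. 6). [Nolin2008]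
-/

noncomputable section

namespace Literature.Probability.Percolation

open LatticeModels Tube

namespace Staircase

/-- **Where a level connector is**, in the frame of its side `i`: lateral coordinate within `e'`
of `-r + l s + s/2` (`l = extIdx n i j` the lateral index of its cell), depth in
`[r - s/2 - 2e', r' + 2e']` (`n s = r ≤ r'`, `s` even, `i < 6`, `j < n`). [folklore] -/
theorem levelConn_bounds {r r' e' s n i j : ℕ} (hns : n * s = r) (hrr' : r ≤ r') (hs2 : 2 ∣ s) (hi : i < 6) (hj : j < n)
    {v : Site 2} (hv : v ∈ (levelConn r r' e' s i j).box) :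
    -(r : ℤ) + (extIdx n i j) * s + (s / 2 : ℕ) - e' ≤ lat i v ∧ lat i v ≤ -(r : ℤ) + (extIdx n i j) * s + (s / 2 : ℕ) + e' ∧
      (r : ℤ) - (s / 2 : ℕ) - 2 * e' ≤ dep i v ∧ dep i v ≤ (r' : ℤ) + 2 * e' := by
  obtain ⟨c, rfl⟩ := hs2
  have hns' : (n : ℤ) * (2 * c : ℕ) = r := by exact_mod_cast hns
  have hrr : (r : ℤ) ≤ r' := by exact_mod_cast hrr'
  have hc2 : (2 * c : ℕ) / 2 = c := by omega
  rw [hc2]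
  have hsub : ((r' - r : ℕ) : ℤ) = r' - r := by omega
  have hjs : (j : ℤ) * (2 * c : ℕ) + (2 * c : ℕ) ≤ n * (2 * c : ℕ) := by
    have := Nat.mul_le_mul_right (2 * c) hj; push_cast [Nat.succ_mul] at this ⊢; linarith
  have hj0 : (0 : ℤ) ≤ (j : ℤ) * (2 * c : ℕ) := by positivity
  have hcast : (((n - 1 - j : ℕ) : ℤ)) * (2 * (c : ℤ)) = n * (2 * (c : ℤ)) - 2 * c - j * (2 * (c : ℤ)) := by
    rw [Nat.cast_sub (by omega), Nat.cast_sub (by omega)]; push_cast; ring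
  push_cast at hns' hjs hj0
  interval_cases i <;> simp only [levelConn] at hv <;>
    simp only [lat, dep, extIdx, Nat.reduceMod, Nat.reduceEqDiff, reduceIte]
  · rw [Tube.mem_box] at hv; simp only [connV] at hv; push_cast [hsub] at hv ⊢; omega
  · rw [Tube.mem_box] at hv; simp only [connD] at hv; push_cast [hsub] at hv ⊢; omega
  · rw [Tube.mem_box] at hv; simp only [connH] at hv; push_cast [hsub] at hv ⊢; rw [hcast]; omega
  · rw [mem_box_neg, Tube.mem_box] at hv; simp only [connV, Pi.neg_apply] at hv; push_cast [hsub] at hv ⊢; omega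
  · rw [mem_box_neg, Tube.mem_box] at hv; simp only [connD, Pi.neg_apply] at hv; push_cast [hsub] at hv ⊢; omega
  · rw [mem_box_neg, Tube.mem_box] at hv; simp only [connH, Pi.neg_apply] at hv; push_cast [hsub] at hv ⊢; rw [hcast]; omega

/-- **A level connector away from the corners is disjoint from the ring tubes of the other sides,
and from the tubes of its side two cells away** — on both rings it joins (`R = r` or `R = r'`,
`n s = r`, `n' s = r'`, `N s = R`, `n ≤ n'`; `s` even, `1 ≤ s`, `4e ≤ s`, `2e' ≤ s`; connector cell
`2 ≤ j ≤ n - 3`; lateral condition in absolute coordinates). [cite: Nolin2008, §4.3 Prop. 12 (proof) (arXiv 0711.4948: Prop. 11), corridors kept apart; §4.4 Fig. 6] -/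
theorem levelConn_disjoint_ringTube {r r' R e e' s n n' N i j g : ℕ}
    (hns : n * s = r) (hn's : n' * s = r') (hNs : N * s = R) (hR : R = r ∨ R = r') (hnn' : n ≤ n')
    (hs2 : 2 ∣ s) (hes : 4 * e ≤ s) (hes' : 2 * e' ≤ s) (hs1 : 1 ≤ s)
    (hi : i < 6) (hj2 : 2 ≤ j) (hjn : j + 3 ≤ n) (hg : g < 12 * (R / s) - 4)
    (hfar : ringSide R s g ≠ i ∨
      (-(R : ℤ) + ringLat R s g * s + 2 * s ≤ -(r : ℤ) + extIdx n i j * s ∨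
        -(r : ℤ) + extIdx n i j * s + 2 * s ≤ -(R : ℤ) + ringLat R s g * s)) :
    Disjoint (levelConn r r' e' s i j).box (ringTube R e s g).box := by
  have hrr' : r ≤ r' := by rw [← hns, ← hn's]; exact Nat.mul_le_mul_right _ hnn'
  have hNn : n ≤ N := by
    rcases hR with h | h
    · have : N * s = n * s := by rw [hNs, hns, h]
      exact (Nat.eq_of_mul_eq_mul_right (by omega) this).symm.le
    · have : N * s = n' * s := by rw [hNs, hn's, h]
      exact (Nat.eq_of_mul_eq_mul_right (by omega) this) ▸ hnn'
  have hRN : R / s = N := by rw [← hNs, Nat.mul_div_cancel _ (by omega)]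
  have hN1 : 1 ≤ R / s := by rw [hRN]; omega
  have hsR : s ∣ R := ⟨N, by rw [← hNs, Nat.mul_comm]⟩
  have heR : 2 * e ≤ R := by
    have : s ≤ R := by rw [← hNs]; exact Nat.le_mul_of_pos_left _ (by omega)
    omega
  rw [Set.disjoint_left]
  intro v hv hv'
  obtain ⟨hc1, hc2, hc3, hc4⟩ := levelConn_bounds (e' := e') hns hrr' hs2 hi (by omega) hv
  obtain ⟨hsec, hl1, hl2, -, -⟩ := ringTube_bounds hN1 hsR heR hg hv'
  obtain ⟨hd1, hd2⟩ := ringTube_dep hg hv'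
  have hlt' := ringLat_lt (r := R) (s := s) (g := g) hN1
  have hi6' := ringSide_lt R s g
  rw [hRN] at hlt'
  rw [add_mul, one_mul] at hl2
  -- linear envelopes of the products
  have hns' : (n : ℤ) * s = r := by exact_mod_cast hns
  have hn's' : (n' : ℤ) * s = r' := by exact_mod_cast hn's
  have hNs' : (N : ℤ) * s = R := by exact_mod_cast hNs
  have hs0 : (0 : ℤ) ≤ s := by positivity
  have hl : extIdx n i j + 3 ≤ n ∧ 2 ≤ extIdx n i j := by unfold extIdx; split_ifs <;> omega
  have hL0 : 2 * (s : ℤ) ≤ (extIdx n i j : ℤ) * s := by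
    have := mul_le_mul_of_nonneg_right (show (2 : ℤ) ≤ extIdx n i j by exact_mod_cast hl.2) hs0; linarith
  have hL1 : (extIdx n i j : ℤ) * s + 3 * s ≤ r := by
    have := mul_le_mul_of_nonneg_right (show (extIdx n i j : ℤ) + 3 ≤ n by exact_mod_cast hl.1) hs0; linarith
  have hL0' : (0 : ℤ) ≤ (ringLat R s g : ℤ) * s := by positivity
  have hL1' : (ringLat R s g : ℤ) * s + s ≤ R := by
    have := mul_le_mul_of_nonneg_right (show (ringLat R s g : ℤ) + 1 ≤ N by exact_mod_cast hlt') hs0; linarith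
  have hes2 : 4 * (e : ℤ) ≤ s := by exact_mod_cast hes
  have hes2' : 2 * (e' : ℤ) ≤ s := by exact_mod_cast hes'
  have hs1' : (1 : ℤ) ≤ s := by exact_mod_cast hs1
  have hrr : (r : ℤ) ≤ r' := by exact_mod_cast hrr'
  have hRr : (R : ℤ) = r ∨ (R : ℤ) = r' := by rcases hR with h | h <;> simp [h]
  have h22 : 2 * ((s / 2 : ℕ) : ℤ) ≤ s ∧ (s : ℤ) ≤ 2 * ((s / 2 : ℕ) : ℤ) + 1 := by constructor <;> omega
  generalize hI' : ringSide R s g = i' at hsec hl1 hl2 hd1 hd2 hi6' hfar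
  generalize (extIdx n i j : ℤ) * s = Ls at hc1 hc2 hL0 hL1 hfar
  generalize (ringLat R s g : ℤ) * s = Ls' at hl1 hl2 hL0' hL1' hfar
  generalize ((s / 2 : ℕ) : ℤ) = sh at hc1 hc2 hc3 h22
  clear hv hv' hg hlt' hl hRN hsR heR hN1
  interval_cases i <;> interval_cases i' <;>
    simp only [sectorNear, lat, dep, Set.mem_setOf_eq, ne_eq, not_true_eq_false, false_or,
      Nat.reduceEqDiff] at hsec hl1 hl2 hd1 hd2 hc1 hc2 hc3 hc4 hfar <;> omega

end Staircase

end Literature.Probability.Percolation
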